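import Literature.MathematicalPhysics.QuantumFieldTheory.Balaban1983to89.B9SectBL2GFrameV7
import Literature.MathematicalPhysics.QuantumFieldTheory.Balaban1983to89.B9SectBL2GCrossY
import Literature.MathematicalPhysics.QuantumFieldTheory.Balaban1983to89.B9SectBGFrameCodedY

/-!
# `Balaban1983to89.B9SectBL2GFrameCodedY` — ★★★ THE `L²` FRAME `L2GFrame₇` OVER THE CODED CARRIERS OF A SUBFAMILY, INHABITED FOR `KACU`, and ★★
# `stepL2Pos_KACU_frame_on` — THE (3.46) MEMBER OF THE SECT.-B STEP OF RECORD, G SIDE (pub-ymgap N06 row 13: the last of the seven G-side members)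

T. Bałaban, *Propagators for lattice gauge theories in a background field*, Commun. Math. Phys. **99** (1985) 389–434
[`Balaban1985BackgroundPropagators`, "B9"], Theorem 3.4 p. 400, Theorem 3.3 p. 399, Theorem 3.1 (3.46) p. 398, (3.15) p. 393, (3.24) p. 394, (3.77) p. 406,
(3.80)–(3.86) p. 407; [4] = T. Bałaban, *Propagators and renormalization transformations for lattice gauge theories. II*, Commun. Math. Phys. **96** (1984)
223–250 [`Balaban1984PropagatorsII`], Lemma 2.1 p. 234, Prop. 2.6 (2.140)–(2.141) p. 247.

statement-level skeleton of published theorems with citation tags; proofs where landed; nothing here is a claim about the Yang–Mills mass gap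

WHY THIS FILE (seat dag-n06-c gen 14).  gen 13's `B9SectBGFrameCodedY.gFrame₅CodedOn` is the G dictionary INHABITED at NODE 00's coded letters; gen 14's
`h1GFrame₆CodedOn` ∕ `e4h2GFrame₆CodedOn` added the Hölder members.  This file adds the `L²` member: the instance of gen 14's `B9SectBL2GFrameV7.L2GFrame₇`
over the same letters, with the `L²` reading `readGL2` PROVED (gen 14's `B9SectBL2GReadY` → `…ReadCodedY` → `…CrossY.readGL2_GbC_all`: the (3.46) block of
`KACU` at a regular base ⇒ every orientation of the six bond letters in block-`ℓ²`, [4] Lemma 2.1 from n06-k's `exists_d261`, the scale transfers of p. 398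
from `scaleTransfer6_window_geo9Y`, the plaquette law from the displayed class law `hreg335P`), the `L²` writing `writeGL2` PROVED (`writeGL2_GbC`), and
FOUR DISPLAYED PRINTED LETTER LAWS in block-`ℓ²`, stated as predicates on gen 13's G frame (§1): `L2SizeQb` ((3.15) for `Q(U)`, `Q*(U)`), `L2SizeF₂` ((3.81)
for `F₂(A)`, `F₂*(A)`), `L2SizeAb` ((3.24) for the weight letter), `Read377L2` ((3.77) for the concrete `P₁(A)`) — record-level dischargeable (def-Y's
averaging numerals ∕ this lineage's successor), exactly like gen 13's displayed `hreg335P`, `hC37G`, `hvarB`.  ★★★ `l2GFrame₇CodedOn`; ★★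
`stepL2Pos_KACU_frame_on := stepL2Pos_of_l2GFrame₇` GIVEN the Lemma-2.1 datum `(d261, h261)` — the (3.46) member of `SectBStepU`'s G side.

HONEST SCOPE.  An instance of a hypothesis structure over DEFINED letters; the four printed ℓ² letter laws and gen 13's laws are DISPLAYED binders; nothing of
[B9] asserted beyond the tree's theorems; N06 NOT discharged; count-neutral; nothing continuum ∕ OS ∕ mass-gap ∕ Clay.  Cell `pub-ymgap` (HUMAN RULING
D-0062), Track A node N06 [B9], N06-ASSIGNMENT row 13, 2026-08-29.

RELATED IN THE TREE, NOT DUPLICATED (used by name): `B9SectBGFrameCodedY` (`gFrame₅CodedOn`, binders), `B9SectBL2GFrameV7` (`L2GFrame₇`,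
`stepL2Pos_of_l2GFrame₇`), `B9SectBL2GCrossY` (`readGL2_GbC_all`, `cLGY`, `plaqLawY_of_reg335PlaqY`), `B9SectBL2GReadCodedY` (`writeGL2_GbC`),
`B9SectBGpFrameCodedY.exists_d261`, `B9RWSums347DefiniteFacesWindow.scaleTransfer6_window_geo9Y`.
-/

noncomputable section

namespace Literature.MathematicalPhysics.QuantumFieldTheory.Balaban1983to89.B9SectBL2GFrameCodedY

open B6Ineq2142KLevelV1 (β)
open B6KLevelCensusIndexV1 (KIdx kGeo)
open B6RandomWalk (Ineq261)
open B6RandomWalkL2 (HasL2Majorant hasL2Majorant_mono)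
open B9Thm34Ext (toB6)
open B9Ineq347 (ScaleTransfer)
open B9FromB6 (EBlock L2Block pref6_nonneg)
open B9Eq352DivFormLetters (conj)
open B9Eq352GradLetters (diffLetter)
open B9Eq371GradLetters (bT bU)
open B9PinMembersKLevelV1 (MemberY geo9Y bg9Y)
open B9Eq360DeltaPrimeAY (AfldY)
open B9SectBGpLettersY (GVal)
open B9SectBGpFrameCodedY (codingYx CplxLettersY exists_d261)
open B9SectBGpReadingsY (KSC)
open B9SectBCodedCarrier (pullS)
open B9SectBCodedReadingsU (KACU)
open B9SectBKerFrameCodedY (CinvY)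
open B9SectBStepWhole (StepL2Pos)
open B9RWSumsReadsNbr (nbr mem_nbr)
open B9RWSums347DefiniteFacesWindow (scaleTransfer6_window_geo9Y)
open B9SectBGClassLettersY (Reg335PlaqY CplxLettersGY VarParBY)
open B9SectBGFrameV5 (GFrame₅)
open B9SectBGFrameCodedY (gFrame₅CodedOn)
open B9SectBL2GFrameV7 (L2GFrame₇ stepL2Pos_of_l2GFrame₇)
open B9SectBL2GCrossY (cLGY cLGY_nonneg readGL2_GbC_all plaqLawY_of_reg335PlaqY)
open B9SectBL2GReadCodedY (writeGL2_GbC)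
open B9Thm34GL2Entries (pOneConc)
open B9GeoLemma21KLevelV1 (geo9K_one_le_L geo9Y_len_pos)
open B9GeoNormsKLevelV1 (geo9K_l2Norm_nonneg geo9K_cutSup_nonneg)
open Node00 (SiteY BlkY FBondY IBondY CfgY SiteParY BondParY GAY GpY XY deltaAY deltaPrimeAY)

universe u

variable {d ℓ : ℕ} {hd : 1 ≤ d + 1} {hL : Odd (ℓ + 1) ∧ 1 < ℓ + 1} {b₀ b₁ : ℝ} {Mstar : ℕ}
variable {𝔸 : Type} [NormedRing 𝔸] [NormedAlgebra ℂ 𝔸] [CompleteSpace 𝔸]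

/-! ## §1 The four displayed printed letter laws in block-`ℓ²`, as predicates on a G frame -/

section Laws

variable {I : Type} {c35 : ℝ} {geo : I → B9.Geometry} {bg : I → B9.Backgrounds} {Gp : ∀ i, B9.KernelFamily (geo i) (bg i)}
  {ι : Type} [Fintype ι] [DecidableEq ι] {b : Module.Basis ι ℝ 𝔸} {κ : Type} [Fintype κ] [LinearOrder κ]
  {S : I → Type} [∀ i, Fintype (S i)] [∀ i, DecidableEq (S i)] [∀ i, Fintype (geo i).Site] [∀ i, DecidableEq (geo i).Site] [∀ i, Nonempty (geo i).Site]
  {P : I → Type} [∀ i, Fintype (P i)] [∀ i, DecidableEq (P i)] {GA : ∀ i, B9.KernelFamily (geo i) (bg i)} {Cinv : ∀ i, B9.SiteKernel (geo i) (bg i)}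

/-- **(3.15) IN BLOCK-`ℓ²` FOR THE BOND LETTERS `Q(U)`, `Q*(U)·vol` OF A G FRAME** at regular bases (the fields `hQb2`, `hQsb2` of `L2GFrame₇`; Schur's test on
print's averaging kernels (3.12)–(3.14)). A named hypothesis. [cite: Balaban1985BackgroundPropagators, (3.12)–(3.15) p.393; Balaban1984PropagatorsII, Prop. 2.6 (2.140) p.247] -/
def L2SizeQb (F : GFrame₅ c35 geo bg Gp b κ S P GA Cinv) (κ2 : ℝ) : Prop :=
  ∀ i (α₀ : ℝ) (U : (bg i).Cfg) (δ : ℝ), F.MInv ≤ (geo i).M → 0 < α₀ → (geo i).M * α₀ ≤ F.aInv → (bg i).Reg335 c35 α₀ U → 0 < δ → δ ≤ F.δcap →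
    HasL2Majorant (g := toB6 (geo i) (F.Rr i) (F.Hp i)) (fun q : (κ × S i) × ι => F.blk i q.1.2) (F.Qb i U)
        (fun a a' => κ2 * Real.exp (-(δ * (geo i).dist a a'))) ∧
      HasL2Majorant (g := toB6 (geo i) (F.Rr i) (F.Hp i)) (fun q : (κ × S i) × ι => F.blk i q.1.2) (F.Qsb i U)
        (fun a a' => κ2 * Real.exp (-(δ * (geo i).dist a a')))

/-- **(3.81) IN BLOCK-`ℓ²` FOR `F₂(A)`, `F₂*(A)`** on the class (3.37) (the field `hF₂2`). A named hypothesis. [cite: Balaban1985BackgroundPropagators, (3.80)–(3.81) p.407; Balaban1984PropagatorsII, Prop. 2.6 (2.140) p.247] -/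
def L2SizeF₂ (F : GFrame₅ c35 geo bg Gp b κ S P GA Cinv) (c2 : ℝ) : Prop :=
  ∀ i (α₁ : ℝ) (U U' : (bg i).Cfg), 0 < α₁ → (bg i).Cplx337 α₁ U U' → ∀ δ : ℝ, 0 < δ → δ ≤ F.δcap →
    HasL2Majorant (g := toB6 (geo i) (F.Rr i) (F.Hp i)) (fun q : (κ × S i) × ι => F.blk i q.1.2) (F.F₂ i U U')
        (fun a a' => c2 * α₁ * Real.exp (-(δ * (geo i).dist a a'))) ∧
      HasL2Majorant (g := toB6 (geo i) (F.Rr i) (F.Hp i)) (fun q : (κ × S i) × ι => F.blk i q.1.2) (F.F₂s i U U')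
        (fun a a' => c2 * α₁ * Real.exp (-(δ * (geo i).dist a a')))

/-- **(3.24) IN BLOCK-`ℓ²` FOR THE WEIGHT LETTER `a`** (block-diagonal, entries `≦ ā₂(Lʲη)⁻²`; the field `ha2`). A named hypothesis.
[cite: Balaban1985BackgroundPropagators, (3.24) p.394, (3.26) p.395] -/
def L2SizeAb (F : GFrame₅ c35 geo bg Gp b κ S P GA Cinv) (abar2 : ℝ) : Prop :=
  ∀ i, HasL2Majorant (g := toB6 (geo i) (F.Rr i) (F.Hp i)) (fun q : (κ × S i) × ι => F.blk i q.1.2) (F.ab i)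
    (fun a a' : (geo i).Site => if a = a' then abar2 * ((geo i).len a ^ 2)⁻¹ else 0)

/-- **(3.77) IN BLOCK-`ℓ²` FOR THE CONCRETE `P₁(A)` AT A G FRAME's LETTERS** (the field `read377` of `L2GFrame₇`; at the V2∕V3 letters it is g6's theorem
`B9SectBL2GStepAtLettersV3.read377_of_l2GFrame₃`). A named hypothesis. [cite: Balaban1985BackgroundPropagators, (3.77) p.406, (3.49) p.399, (3.68) p.403] -/
def Read377L2 (F : GFrame₅ c35 geo bg Gp b κ S P GA Cinv) : Prop :=
  ∀ (B₀ δ₀ B₁ δ₁ : ℝ), 0 < B₀ → 0 < δ₀ → 0 < B₁ → 0 < δ₁ →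
    ∃ M₇ a₇ κ₇ ρ₇ : ℝ, 0 < M₇ ∧ 0 < a₇ ∧ 0 ≤ κ₇ ∧ 0 < ρ₇ ∧
      ∀ i (α₀ : ℝ) (U : (bg i).Cfg), M₇ ≤ (geo i).M → 0 < α₀ → (geo i).M * α₀ ≤ F.aInv → (bg i).Reg335 c35 α₀ U →
        EBlock (Gp i) B₀ δ₀ U → L2Block (Gp i) B₀ δ₀ U →
        (∀ y y' : (geo i).Site, |(Cinv i).ker U y y'| ≤
          B₁ * ((geo i).len y) ^ (-(4 : ℝ)) * ((geo i).len y') ^ (-(F.dB : ℝ)) * Real.exp (-(δ₁ * (geo i).dist y y'))) →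
        ∀ (α₁ : ℝ) (U' : (bg i).Cfg), 0 < α₁ → α₁ ≤ a₇ → (bg i).Cplx337 α₁ U U' →
          HasL2Majorant (g := toB6 (geo i) (F.Rr i) (F.Hp i)) (fun q : (κ × S i) × ι => F.blk i q.1.2)
            (pOneConc b (F.T i) (F.coord i U) (geo i).eta (F.expA i U U')
              (F.Gop i U ∘ₗ F.Qcs i U ∘ₗ F.Cop i U ∘ₗ F.Qc i U ∘ₗ F.Gop i U)
              (F.Gop i ((bg i).mul U' U) ∘ₗ F.Qcs i ((bg i).mul U' U) ∘ₗ F.Cop i ((bg i).mul U' U) ∘ₗ F.Qc i ((bg i).mul U' U) ∘ₗ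
                F.Gop i ((bg i).mul U' U)))
            (fun a a' => κ₇ * α₁ * ((geo i).len a ^ 2)⁻¹ * Real.exp (-(ρ₇ * (geo i).dist a a')))

end Laws

/-! ## §2 Record suppliers: [4] Lemma 2.1, a radius bookkeeping, the `L²` block is monotone in its constant -/

section Suppliers

variable [∀ x : MemberY d ℓ hd hL b₀ b₁ Mstar, Fintype (geo9Y x).Site]

/-- n06-k's Lemma-2.1 exponent function at the record (the choice of `B9SectBGpFrameCodedY.exists_d261`). [cite: Balaban1984PropagatorsII, Lemma 2.1 (2.61) p.234] -/
def d261Y : ℝ → ℕ :=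
  Classical.choose (exists_d261 (d := d) (ℓ := ℓ) (hd := hd) (hL := hL) (b₀ := b₀) (b₁ := b₁) (Mstar := Mstar))

/-- its M-threshold. [cite: Balaban1984PropagatorsII, Lemma 2.1 (2.59) p.233] -/
def M261Y : ℝ → ℝ :=
  Classical.choose (Classical.choose_spec (exists_d261 (d := d) (ℓ := ℓ) (hd := hd) (hL := hL) (b₀ := b₀) (b₁ := b₁) (Mstar := Mstar)))

/-- the specification: (2.61) at every rate `δ > 0`, exponent `α ∈ [9/5000, 1]`, above the threshold. [cite: Balaban1984PropagatorsII, Lemma 2.1 (2.61) p.234] -/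
theorem d261Y_spec (x : MemberY d ℓ hd hL b₀ b₁ Mstar) {δ α : ℝ} (hδ : 0 < δ) (hα : 9 / 5000 ≤ α) (hα1 : α ≤ 1)
    (hM : M261Y (d := d) (ℓ := ℓ) (hd := hd) (hL := hL) (b₀ := b₀) (b₁ := b₁) (Mstar := Mstar) δ ≤ (geo9Y x).M) :
    Ineq261 (d261Y (d := d) (ℓ := ℓ) (hd := hd) (hL := hL) (b₀ := b₀) (b₁ := b₁) (Mstar := Mstar) δ) (toB6 (geo9Y x) (0 : ℝ) True) δ α :=
  Classical.choose_spec (Classical.choose_spec (exists_d261 (d := d) (ℓ := ℓ) (hd := hd) (hL := hL) (b₀ := b₀) (b₁ := b₁) (Mstar := Mstar))) x δ α hδ hα hα1 hM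

/-- neighbourhoods grow with the radius. [cite: Balaban1985BackgroundPropagators, p.397 (Δ̃(y)), bookkeeping] -/
theorem card_nbr_mono (x : MemberY d ℓ hd hL b₀ b₁ Mstar) {r r' : ℝ} (h : r ≤ r') (y : (geo9Y x).Site) :
    (nbr (geo9Y x) r y).card ≤ (nbr (geo9Y x) r' y).card := by
  classical
  refine Finset.card_le_card fun y'' hy'' => ?_
  rw [mem_nbr] at hy'' ⊢
  exact hy''.trans h

omit [∀ x : MemberY d ℓ hd hL b₀ b₁ Mstar, Fintype (geo9Y x).Site] in
/-- the `L²` block is monotone in its constant. [cite: Balaban1985BackgroundPropagators, (3.46) p.398, bookkeeping] -/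
theorem l2Block_mono_const (x : MemberY d ℓ hd hL b₀ b₁ Mstar) {B : B9.Backgrounds} (K : B9.KernelFamily (geo9Y x) B) {B₀ B₀' δ : ℝ} {U : B.Cfg}
    (h : L2Block K B₀ δ U) (hle : B₀ ≤ B₀') : L2Block K B₀' δ U := by
  intro n lam hh y y' hc hs
  refine (h n lam hh y y' hc hs).trans ?_
  have h1 : 0 ≤ B9.pref6 ((geo9Y x).len y) n := pref6_nonneg (geo9Y_len_pos x y).le n
  have h2 : 0 ≤ (geo9Y x).cutSup hh := geo9K_cutSup_nonneg x.toKIdx hh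
  have h3 : 0 ≤ (geo9Y x).l2Norm lam := geo9K_l2Norm_nonneg x.toKIdx lam
  exact mul_le_mul_of_nonneg_right (mul_le_mul_of_nonneg_right (mul_le_mul_of_nonneg_right (mul_le_mul_of_nonneg_right hle h1) h2)
    (Real.exp_nonneg _)) h3

end Suppliers

/-! ## §3 ★★★ The `L²` frame inhabited over the coded carriers of a subfamily -/

section Instance

variable [NormOneClass 𝔸] [FiniteDimensional ℝ 𝔸] {J : Type} (f : J → MemberY d ℓ hd hL b₀ b₁ Mstar)
  [∀ x : MemberY d ℓ hd hL b₀ b₁ Mstar, Fintype (geo9Y x).Site]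
  [instDS : ∀ x : MemberY d ℓ hd hL b₀ b₁ Mstar, DecidableEq (geo9Y x).Site] [instNE : ∀ x : MemberY d ℓ hd hL b₀ b₁ Mstar, Nonempty (geo9Y x).Site]
  (c35 : ℝ) (G : Subgroup 𝔸ˣ) (par : ∀ j : J, SiteParY 𝔸 (f j).toKIdx) (parB : ∀ j : J, BondParY 𝔸 (f j).toKIdx)
  {ι : Type} [Fintype ι] [DecidableEq ι] (b : Module.Basis ι ℝ 𝔸) (ιB : ∀ j : J, BlkY (f j).toKIdx → IBondY (f j).toKIdx)
  (C37 C38 : ∀ j : J, ℝ → CfgY 𝔸 (f j).toKIdx → AfldY 𝔸 (f j).toKIdx → Prop)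

set_option maxHeartbeats 1600000 in
/-- ★★★ **THE `L²` FRAME `L2GFrame₇` OVER THE CODED CARRIERS OF A SUBFAMILY, INHABITED FOR `KACU`**: gen 13's `gFrame₅CodedOn` extended by the `L²` reading
constant `cLG δ = cLGY (2C₀) M₂ S_b s_ι d (d261 δ) δ L⁴`, output rate `δ/2`, threshold `max (M261 δ) (48 log L / δ)`, the writing function
`m_N·c_L·L²·e^{δ}·B + 1`, the `L²` reading PROVED (`readGL2_GbC_all`) and writing PROVED (`writeGL2_GbC`), and the four displayed printed letter laws of §1.
[cite: Balaban1985BackgroundPropagators, Thm 3.4 p.400, Thm 3.3 p.399, (3.46) p.398, p.398 (first remark), (3.15) p.393, (3.24) p.394, (3.77) p.406, (3.80)–(3.86) p.407; Balaban1984PropagatorsII, Lemma 2.1 p.234, Prop. 2.6 (2.140)–(2.141) p.247] -/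
noncomputable def l2GFrame₇CodedOn (hι : ∀ (j : J) (s : BlkY (f j).toKIdx), β (f j).toKIdx.hN (f j).toKIdx.D (f j).toKIdx.hk (ιB j s) = s)
    (hG1 : ∀ u : 𝔸ˣ, u ∈ G → ‖(u : 𝔸)‖ ≤ 1) (hpar : ∀ j (U : CfgY 𝔸 (f j).toKIdx), GVal G (f j).toKIdx U → ∀ z w, par j U z w ∈ G)
    (hunit : ∀ j (U : CfgY 𝔸 (f j).toKIdx), GVal G (f j).toKIdx U → IsUnit (deltaPrimeAY (f j).toKIdx (par j) U))
    (M₂ : ℝ) (hM₂ : 0 ≤ M₂) (hrepr : ∀ (v : 𝔸) (j : ι), |b.repr v j| ≤ M₂ * ‖v‖) (hcR : 0 < M₂ * ∑ j, ‖b j‖)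
    (Cq : ℝ) (hCq : 0 ≤ Cq) (hC37 : ∀ j β' U a, C37 j β' U a → GVal G (f j).toKIdx U ∧ CplxLettersY G (f j) (par j) (ιB j) Cq β' U a)
    (MInv aInv aW : ℝ) (hMInv : 0 < MInv) (haInv : 0 < aInv) (haW : 0 < aW)
    (hunitX : ∀ j (U : CfgY 𝔸 (f j).toKIdx), GVal G (f j).toKIdx U → IsUnit (XY (f j).toKIdx (par j) (GpY (f j).toKIdx (par j)) U))
    (hsym : ∀ j (U : CfgY 𝔸 (f j).toKIdx) (z w : SiteY (f j).toKIdx), par j U z w = (par j U w z)⁻¹)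
    (hunitA : ∀ j (U : CfgY 𝔸 (f j).toKIdx), GVal G (f j).toKIdx U → IsUnit (deltaAY (f j).toKIdx (par j) (parB j) (GpY (f j).toKIdx (par j)) U))
    (hparB : ∀ j (U : CfgY 𝔸 (f j).toKIdx), GVal G (f j).toKIdx U → ∀ y f', parB j U y f' ∈ G) (hb₁ : 0 ≤ b₁)
    (C₀ : ℝ) (hC₀ : 0 ≤ C₀)
    (hreg335P : ∀ j (α₀ : ℝ) (U : CfgY 𝔸 (f j).toKIdx), MInv ≤ (geo9Y (f j)).M → 0 < α₀ → (geo9Y (f j)).M * α₀ ≤ aInv →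
      (bg9Y 𝔸 G (f j)).Reg335 c35 α₀ U → Reg335PlaqY G (f j) (ιB j) C₀ U)
    (hC37G : ∀ j β' U a, C37 j β' U a → CplxLettersGY G (f j) (ιB j) β' U a)
    (cVar : ℝ) (hcVar : 0 ≤ cVar) (hvarB : ∀ j β' U a, C37 j β' U a → VarParBY (f j).toKIdx (parB j) cVar β' U a)
    (hMd : 2 * ((d : ℝ) + 1) < MInv) (mN : ℕ) (hnbr : ∀ (j : J) (y' : IBondY (f j).toKIdx), (nbr (geo9Y (f j)) (2 * ((d : ℝ) + 1)) y').card ≤ mN)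
    (κ2 : ℝ) (hκ2 : 0 ≤ κ2) (hQbL2 : L2SizeQb (gFrame₅CodedOn f c35 G par parB b ιB C37 C38 hι hG1 hpar hunit M₂ hM₂ hrepr hcR Cq hCq hC37 MInv aInv aW hMInv haInv haW hunitX hsym hunitA hparB hb₁ C₀
        hC₀ hreg335P hC37G cVar hcVar hvarB hMd mN hnbr) κ2)
    (c2 : ℝ) (hc2 : 0 ≤ c2) (hF₂L2 : L2SizeF₂ (gFrame₅CodedOn f c35 G par parB b ιB C37 C38 hι hG1 hpar hunit M₂ hM₂ hrepr hcR Cq hCq hC37 MInv aInv aW hMInv haInv haW hunitX hsym hunitA hparB hb₁ C₀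
        hC₀ hreg335P hC37G cVar hcVar hvarB hMd mN hnbr) c2)
    (abar2 : ℝ) (habar2 : 0 ≤ abar2) (haL2 : L2SizeAb (gFrame₅CodedOn f c35 G par parB b ιB C37 C38 hι hG1 hpar hunit M₂ hM₂ hrepr hcR Cq hCq hC37 MInv aInv aW hMInv haInv haW hunitX hsym hunitA hparB hb₁ C₀
        hC₀ hreg335P hC37G cVar hcVar hvarB hMd mN hnbr) abar2)
    (h377 : Read377L2 (gFrame₅CodedOn f c35 G par parB b ιB C37 C38 hι hG1 hpar hunit M₂ hM₂ hrepr hcR Cq hCq hC37 MInv aInv aW hMInv haInv haW hunitX hsym hunitA hparB hb₁ C₀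
        hC₀ hreg335P hC37G cVar hcVar hvarB hMd mN hnbr)) :
    L2GFrame₇ c35 (fun j => geo9Y (f j)) (fun j => (codingYx G (f j) (C37 j) (C38 j)).bg) (fun j => KSC G (f j) (par j) (C37 j) (C38 j)) b (Fin (d + 1))
      (fun j => SiteY (f j).toKIdx) (fun j => BlkY (f j).toKIdx × ι)
      (fun j => KACU G (f j) (GAY (f j).toKIdx (par j) (parB j) (GpY (f j).toKIdx (par j))) (parB j) (C37 j) (C38 j))
      (fun j => pullS (codingYx G (f j) (C37 j) (C38 j)) (CinvY f G par j)) :=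
  { gFrame₅CodedOn f c35 G par parB b ιB C37 C38 hι hG1 hpar hunit M₂ hM₂ hrepr hcR Cq hCq hC37 MInv aInv aW hMInv haInv haW hunitX hsym hunitA hparB hb₁ C₀
        hC₀ hreg335P hC37G cVar hcVar hvarB hMd mN hnbr with
    cLG := fun δ => cLGY (2 * C₀) M₂ (∑ j, ‖b j‖) (Real.sqrt (Fintype.card ι)) d (d261Y (d := d) (ℓ := ℓ) (hd := hd) (hL := hL) (b₀ := b₀) (b₁ := b₁) (Mstar := Mstar) δ) δ (((ℓ : ℝ) + 1) ^ 4)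
    κQb2 := κ2
    cFb2 := c2
    abar2 := abar2
    wLG := fun B δ => (mN : ℝ) * (Real.sqrt (Fintype.card ι) * M₂ * ∑ j, ‖b j‖) * (((ℓ + 1 : ℕ) : ℝ)) ^ 2 * Real.exp δ * B + 1
    wLGδ := fun δ => δ
    rLG := fun δ => δ / 2
    ML2 := fun δ => max (M261Y (d := d) (ℓ := ℓ) (hd := hd) (hL := hL) (b₀ := b₀) (b₁ := b₁) (Mstar := Mstar) δ) (4 * Real.log ((ℓ : ℝ) + 1) / (δ / 12))
    cLG_pos := fun δ hδ => by
      -- `cLGY = g_X²·g_I·(s_ι M₂ S_b)`, `g ≥ 1`, `s_ι M₂ S_b > 0`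
      have hSb : 0 < ∑ j, ‖b j‖ := by
        rcases (mul_pos_iff.1 hcR) with ⟨-, h⟩ | ⟨h1, -⟩
        · exact h
        · exact absurd h1 (not_lt.2 hM₂)
      have hne : Nonempty ι := by
        by_contra hι'
        rw [not_nonempty_iff] at hι'
        have : ∑ j, ‖b j‖ = 0 := Finset.sum_eq_zero fun j _ => (IsEmpty.false j).elim
        linarith
      have hcard : (0 : ℝ) < Fintype.card ι := by exact_mod_cast Fintype.card_pos
      have hM₂' : 0 < M₂ := by
        rcases (mul_pos_iff.1 hcR) with ⟨h, -⟩ | ⟨-, h2⟩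
        · exact h
        · exact absurd h2 (not_lt.2 hSb.le)
      have hc1 := B6RandomWalk.c1_nonneg (d261Y (d := d) (ℓ := ℓ) (hd := hd) (hL := hL) (b₀ := b₀) (b₁ := b₁) (Mstar := Mstar) δ) δ (1 / 12)
      unfold cLGY
      have hs : 0 < Real.sqrt (Fintype.card ι) * M₂ * ∑ j, ‖b j‖ := by positivity
      have h1 : (1 : ℝ) ≤ (1 + ((1 : ℝ) ^ 2 * M₂ * (∑ j, ‖b j‖) * Real.sqrt (Fintype.card ι) * Real.exp (δ * (2 * ((d : ℝ) + 1)))) *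
          (((ℓ : ℝ) + 1) ^ 4) * B6.c1 (d261Y (d := d) (ℓ := ℓ) (hd := hd) (hL := hL) (b₀ := b₀) (b₁ := b₁) (Mstar := Mstar) δ) δ (1 / 12)) ^ 2 :=
        one_le_pow₀ (le_add_of_nonneg_right (by positivity))
      have h2 : (1 : ℝ) ≤ 1 + B6.c1 (d261Y (d := d) (ℓ := ℓ) (hd := hd) (hL := hL) (b₀ := b₀) (b₁ := b₁) (Mstar := Mstar) δ) δ (1 / 12) * M₂ * (∑ j, ‖b j‖) * Real.sqrt (Fintype.card ι) *
          ((1 : ℝ) ^ 2 * Real.exp (δ * (2 * ((d : ℝ) + 1))) * ((ℓ : ℝ) + 1) ^ 4 +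
            (1 : ℝ) ^ 4 * (2 * C₀) * (((ℓ : ℝ) + 1) ^ 4 * Real.exp (1 / 12 * δ * (2 * ((d : ℝ) + 1)))) *
              Real.exp (δ * (2 * (2 * ((d : ℝ) + 1)))) * ((ℓ : ℝ) + 1) ^ 4) :=
        le_add_of_nonneg_right (by positivity)
      have := mul_le_mul h1 h2 zero_le_one (zero_le_one.trans h1)
      nlinarith
    rLG_pos := fun δ hδ => by positivity
    rLG_le := fun δ hδ => by linarith
    κQb2_nonneg := hκ2
    cFb2_nonneg := hc2
    abar2_nonneg := habar2
    wLG_pos := fun B δ hB _ => by positivity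
    wLGδ_pos := fun δ hδ => hδ
    hQb2 := fun j α₀ c δ hM hα₀ hMa hreg hδ hδc => (hQbL2 j α₀ c δ hM hα₀ hMa hreg hδ hδc).1
    hQsb2 := fun j α₀ c δ hM hα₀ hMa hreg hδ hδc => (hQbL2 j α₀ c δ hM hα₀ hMa hreg hδ hδc).2
    hF₂2 := fun j α₁ c c' hα₁ h37 δ hδ hδc => hF₂L2 j α₁ c c' hα₁ h37 δ hδ hδc
    ha2 := fun j => haL2 j
    readGL2 := fun j α₀ c B₀ δ hM hML hα₀ hMa hreg hB₀ hδ hL2 => by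
      letI : Fintype (B9GeoNormsKLevelV1.geo9K (f j).toKIdx).Site := ‹∀ x : MemberY d ℓ hd hL b₀ b₁ Mstar, Fintype (geo9Y x).Site› (f j)
      obtain ⟨U, rfl, hU⟩ := (codingYx G (f j) (C37 j) (C38 j)).exists_of_bg_Reg335 hreg
      have hM261 : M261Y (d := d) (ℓ := ℓ) (hd := hd) (hL := hL) (b₀ := b₀) (b₁ := b₁) (Mstar := Mstar) δ ≤ (geo9Y (f j)).M := le_trans (le_max_left _ _) hML
      have hMST : 4 * Real.log ((ℓ : ℝ) + 1) / (δ / 12) ≤ (geo9Y (f j)).M := le_trans (le_max_right _ _) hML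
      have h261 := d261Y_spec (f j) hδ (by norm_num : (9 : ℝ) / 5000 ≤ 1 / 12) (by norm_num) hM261
      have hκlo : 0 < δ / 12 := by positivity
      obtain ⟨hT1, -, -, hT2i, -, -⟩ := scaleTransfer6_window_geo9Y hκlo (f j) (δ := δ) (α := 1 / 12) (by linarith) hMST
      have hTi2 : ScaleTransfer (geo9Y (f j)) δ (1 / 12) (((ℓ : ℝ) + 1) ^ 4) (fun a => ((geo9Y (f j)).len a)⁻¹ ^ 2) := by
        have e : (fun a => ((geo9Y (f j)).len a)⁻¹ ^ 2) = (fun a => ((geo9Y (f j)).len a ^ 2)⁻¹) := funext fun a => by rw [inv_pow]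
        rw [e]; exact hT2i
      have hΛ : (1 : ℝ) ≤ ((ℓ : ℝ) + 1) ^ 4 := one_le_pow₀ (by have : (0 : ℝ) ≤ ℓ := Nat.cast_nonneg ℓ; linarith)
      have hplaq := plaqLawY_of_reg335PlaqY G (f j) (ιB j) hG1 hU.1.1 hC₀ (hreg335P j α₀ U hM hα₀ hMa hU)
      exact readGL2_GbC_all G (f j) (par j) (parB j) b (ιB j) (C37 j) (C38 j) (hι j) hG1 hM₂ hrepr hδ h261 hΛ hT1 hTi2 (by positivity) hU.1.1 hplaq
        hB₀.le hL2
    writeGL2 := fun j α₀ c c' α₁ B δ hM hα₀ hMa hreg hα₁ haW' h37 hB hδ h0 h1 h2 h3 h4 h5 => by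
      letI : Fintype (B9GeoNormsKLevelV1.geo9K (f j).toKIdx).Site := ‹∀ x : MemberY d ℓ hd hL b₀ b₁ Mstar, Fintype (geo9Y x).Site› (f j)
      obtain ⟨U, a, rfl, rfl, hC⟩ := (codingYx G (f j) (C37 j) (C38 j)).exists_of_bg_Cplx337 h37
      have hUG := (hC37 j α₁ U a hC).1
      have hnbr1 : ∀ y : IBondY (f j).toKIdx, (nbr (geo9Y (f j)) 1 y).card ≤ mN := fun y =>
        (card_nbr_mono (f j) (by have : (0 : ℝ) ≤ d := Nat.cast_nonneg d; linarith) y).trans (hnbr j y)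
      have hw := writeGL2_GbC (Rr := 0) (Hp := True) G (f j) (par j) (parB j) b (ιB j) (C37 j) (C38 j) (hι j) hM₂ hrepr hnbr1 U hUG a hB hδ.le
        h0 (fun ν => h1 (Sum.inl ν)) (fun ν => h2 (Sum.inr ν)) (fun ν μ => h4 (Sum.inl ν) (Sum.inr μ)) (fun ν μ => h3 (Sum.inl ν) (Sum.inl μ))
        (fun ν μ => h5 (Sum.inr ν) (Sum.inr μ))
      exact l2Block_mono_const (f j) _ hw (by linarith)
    read377 := fun B₀ δ₀ B₁ δ₁ hB₀ hδ₀ hB₁ hδ₁ => h377 B₀ δ₀ B₁ δ₁ hB₀ hδ₀ hB₁ hδ₁ }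

/-- ★★ **`StepL2Pos` OF THE CODED BOND FAMILY `KACU` THROUGH THE `L²` FRAME — THE (3.46) MEMBER OF THE SECT.-B STEP OF RECORD, G SIDE** (gen 14's
`stepL2Pos_of_l2GFrame₇` on `l2GFrame₇CodedOn`), GIVEN the Lemma-2.1 datum `(d261, h261)` of the frame; site family `KSC`, output family
`KACU G (f j) (GAY … (par j) (parB j) (GpY (par j))) (parB j) …`; displayed: gen 13's laws and the four printed ℓ² letter laws of §1.
[cite: Balaban1985BackgroundPropagators, Thm 3.4 p.400, Thm 3.3 p.399, Thm 3.1 (3.46) p.398, (3.82)–(3.86) p.407; Balaban1984PropagatorsII, Lemma 2.1 p.234, Prop. 2.6 (2.140)–(2.141) p.247] -/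
theorem stepL2Pos_KACU_frame_on (hι : ∀ (j : J) (s : BlkY (f j).toKIdx), β (f j).toKIdx.hN (f j).toKIdx.D (f j).toKIdx.hk (ιB j s) = s)
    (hG1 : ∀ u : 𝔸ˣ, u ∈ G → ‖(u : 𝔸)‖ ≤ 1) (hpar : ∀ j (U : CfgY 𝔸 (f j).toKIdx), GVal G (f j).toKIdx U → ∀ z w, par j U z w ∈ G)
    (hunit : ∀ j (U : CfgY 𝔸 (f j).toKIdx), GVal G (f j).toKIdx U → IsUnit (deltaPrimeAY (f j).toKIdx (par j) U))
    (M₂ : ℝ) (hM₂ : 0 ≤ M₂) (hrepr : ∀ (v : 𝔸) (j : ι), |b.repr v j| ≤ M₂ * ‖v‖) (hcR : 0 < M₂ * ∑ j, ‖b j‖)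
    (Cq : ℝ) (hCq : 0 ≤ Cq) (hC37 : ∀ j β' U a, C37 j β' U a → GVal G (f j).toKIdx U ∧ CplxLettersY G (f j) (par j) (ιB j) Cq β' U a)
    (MInv aInv aW : ℝ) (hMInv : 0 < MInv) (haInv : 0 < aInv) (haW : 0 < aW)
    (hunitX : ∀ j (U : CfgY 𝔸 (f j).toKIdx), GVal G (f j).toKIdx U → IsUnit (XY (f j).toKIdx (par j) (GpY (f j).toKIdx (par j)) U))
    (hsym : ∀ j (U : CfgY 𝔸 (f j).toKIdx) (z w : SiteY (f j).toKIdx), par j U z w = (par j U w z)⁻¹)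
    (hunitA : ∀ j (U : CfgY 𝔸 (f j).toKIdx), GVal G (f j).toKIdx U → IsUnit (deltaAY (f j).toKIdx (par j) (parB j) (GpY (f j).toKIdx (par j)) U))
    (hparB : ∀ j (U : CfgY 𝔸 (f j).toKIdx), GVal G (f j).toKIdx U → ∀ y f', parB j U y f' ∈ G) (hb₁ : 0 ≤ b₁)
    (C₀ : ℝ) (hC₀ : 0 ≤ C₀)
    (hreg335P : ∀ j (α₀ : ℝ) (U : CfgY 𝔸 (f j).toKIdx), MInv ≤ (geo9Y (f j)).M → 0 < α₀ → (geo9Y (f j)).M * α₀ ≤ aInv →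
      (bg9Y 𝔸 G (f j)).Reg335 c35 α₀ U → Reg335PlaqY G (f j) (ιB j) C₀ U)
    (hC37G : ∀ j β' U a, C37 j β' U a → CplxLettersGY G (f j) (ιB j) β' U a)
    (cVar : ℝ) (hcVar : 0 ≤ cVar) (hvarB : ∀ j β' U a, C37 j β' U a → VarParBY (f j).toKIdx (parB j) cVar β' U a)
    (hMd : 2 * ((d : ℝ) + 1) < MInv) (mN : ℕ) (hnbr : ∀ (j : J) (y' : IBondY (f j).toKIdx), (nbr (geo9Y (f j)) (2 * ((d : ℝ) + 1)) y').card ≤ mN)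
    (κ2 : ℝ) (hκ2 : 0 ≤ κ2) (hQbL2 : L2SizeQb (gFrame₅CodedOn f c35 G par parB b ιB C37 C38 hι hG1 hpar hunit M₂ hM₂ hrepr hcR Cq hCq hC37 MInv aInv aW hMInv haInv haW hunitX hsym hunitA hparB hb₁ C₀
        hC₀ hreg335P hC37G cVar hcVar hvarB hMd mN hnbr) κ2)
    (c2 : ℝ) (hc2 : 0 ≤ c2) (hF₂L2 : L2SizeF₂ (gFrame₅CodedOn f c35 G par parB b ιB C37 C38 hι hG1 hpar hunit M₂ hM₂ hrepr hcR Cq hCq hC37 MInv aInv aW hMInv haInv haW hunitX hsym hunitA hparB hb₁ C₀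
        hC₀ hreg335P hC37G cVar hcVar hvarB hMd mN hnbr) c2)
    (abar2 : ℝ) (habar2 : 0 ≤ abar2) (haL2 : L2SizeAb (gFrame₅CodedOn f c35 G par parB b ιB C37 C38 hι hG1 hpar hunit M₂ hM₂ hrepr hcR Cq hCq hC37 MInv aInv aW hMInv haInv haW hunitX hsym hunitA hparB hb₁ C₀
        hC₀ hreg335P hC37G cVar hcVar hvarB hMd mN hnbr) abar2)
    (h377 : Read377L2 (gFrame₅CodedOn f c35 G par parB b ιB C37 C38 hι hG1 hpar hunit M₂ hM₂ hrepr hcR Cq hCq hC37 MInv aInv aW hMInv haInv haW hunitX hsym hunitA hparB hb₁ C₀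
        hC₀ hreg335P hC37G cVar hcVar hvarB hMd mN hnbr)) (d261 : ℝ → ℕ)
    (h261 : ∀ (j : J) (δ α : ℝ), 0 < δ → δ ≤ 1 → 9 / 5000 ≤ α → α < 1 →
      (gFrame₅CodedOn f c35 G par parB b ιB C37 C38 hι hG1 hpar hunit M₂ hM₂ hrepr hcR Cq hCq hC37 MInv aInv aW hMInv haInv haW hunitX hsym hunitA hparB hb₁ C₀
        hC₀ hreg335P hC37G cVar hcVar hvarB hMd mN hnbr).M261 δ ≤ (geo9Y (f j)).M →
      Ineq261 (d261 δ) (toB6 (geo9Y (f j)) 0 True) δ α) :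
    StepL2Pos (d + 1) c35 (fun j => geo9Y (f j)) (fun j => (codingYx G (f j) (C37 j) (C38 j)).bg) (fun j => KSC G (f j) (par j) (C37 j) (C38 j))
      (fun j => KACU G (f j) (GAY (f j).toKIdx (par j) (parB j) (GpY (f j).toKIdx (par j))) (parB j) (C37 j) (C38 j))
      (fun j => pullS (codingYx G (f j) (C37 j) (C38 j)) (CinvY f G par j))
      (fun j => KACU G (f j) (GAY (f j).toKIdx (par j) (parB j) (GpY (f j).toKIdx (par j))) (parB j) (C37 j) (C38 j)) :=
  stepL2Pos_of_l2GFrame₇ (F := l2GFrame₇CodedOn f c35 G par parB b ιB C37 C38 hι hG1 hpar hunit M₂ hM₂ hrepr hcR Cq hCq hC37 MInv aInv aW hMInv haInv haW hunitX hsym hunitA hparB hb₁ C₀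
        hC₀ hreg335P hC37G cVar hcVar hvarB hMd mN hnbr κ2 hκ2 hQbL2 c2 hc2 hF₂L2 abar2 habar2 haL2 h377) d261 h261

end Instance

end Literature.MathematicalPhysics.QuantumFieldTheory.Balaban1983to89.B9SectBL2GFrameCodedY

end
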